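import Summits.AnomalousDissipation.AnomalousDissipation.Theses.ImpulseGrid
import Summits.AnomalousDissipation.AnomalousDissipation.Theses.Correlation
import Summits.AnomalousDissipation.AnomalousDissipation.Theorems.ImpulseGridBoundedEnergyNoLeakGridOfNoMeanLeakage
import Summits.AnomalousDissipation.AnomalousDissipation.Theorems.ImpulseGridBoundedEnergyNoLeakGridRegularDriftStatesHardness
import Literature.Analysis.FluidPDE.LerayHopfGalileanTorus
import Literature.Analysis.FluidPDE.LerayHopfGalileanTorusMeans
import Literature.Analysis.FunctionSpaces.TorusAxisAverageCalculus
import HarnessLib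

/-!
# `ImpulseGrid.BoundedEnergyNoLeakGrid` is at least as hard as Correlation's zero-momentum cruxes —
# at the Leray–Hopf level (crux stmt-AnomalousDissipation-14350, line `Sketch`, lead c2)

Support file for the crux `Summit.AnomalousDissipation.AnomalousDissipation.Theses.ImpulseGrid.BoundedEnergyNoLeakGrid`
(item stmt-AnomalousDissipation-14350).  The earlier hardness certificate
(`ImpulseGridBoundedEnergyNoLeakGridRegularDriftStatesHardness`) concerned the REGULAR residual of the line; this file
proves the same for the CRUX ITSELF and for its necessary Leray–Hopf residual UEDF
(`uniformEnergyDriftFamilies_of_boundedEnergyNoLeakGrid`), using the Galilean covariance of global Leray–Hopf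
solutions on `T³` (`Literature.Analysis.FluidPDE.Torus.IsGlobalLerayHopf.galilean_unboost_update`):

* `boundedEnergyFamilyZM_of_uniformEnergyDriftFamilies` : UEDF → `Correlation.BoundedEnergyFamilyZM` (stmt-14641,
  turbulent saturation at zero momentum);
* `boundedEnergyFamilyZM_of_boundedEnergyNoLeakGrid` : crux → `Correlation.BoundedEnergyFamilyZM`;
* `boundedEnergyEqualityZM_of_boundedEnergyNoLeakGrid` : crux → `Correlation.BoundedEnergyEqualityZM` (stmt-14640,
  the same with mean energy equality);
* the registered sub-goal wrappers `lhGalilean_isWeakNSSolutionForcedOn`, `lhGalilean_isLerayHopfOn`,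
  `lhGalilean_isGlobalLerayHopf` (the `T³` instances of the Literature covariance theorems).

Mechanism.  At the admissible design `Φ ≡ 1`, `c = 1` with the columnar pattern `G = sin(2πx₁) e₂`
(`RegularDriftStatesHardness.exists_columnar_pattern`) the crux / UEDF give `ν_j → 0⁺` and global Leray–Hopf
families `u_j` under the `x₀`-INVARIANT steady force `G` with drift data `∫ u₀ j = e₀` and `meanEnergy (u j) ≤ E`.
In the frame moving with `e₀`, `v_j t y := u_j t (y + [t e₀]) − e₀` (after the harmless normalisation `u_j 0 := u₀ j`)
is a global Leray–Hopf solution under the swept force `G(· + [t e₀]) = G` from the ZERO-MOMENTUM datum `u₀ j − e₀`,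
with `meanEnergy (v j) ≤ 2E + 2`, the same mean power input `⟨(G, v_j)⟩ = ⟨(G, u_j)⟩` and the same mean dissipation
(`LerayHopfGalileanTorusMeans`) — so bounded energy and no-leakage pass to the zero-momentum family verbatim.

Consequences for the ledger: any proof of stmt-14350 proves stmt-14641 and stmt-14640 (both `[difficulty:
open-problem]`), uniformly in the columnar pattern; and `Correlation.EnergyUnboundedNegZM` (stmt-14642) refutes
stmt-14350 (`Theorems/BoundedEnergyNoLeakGrid/Negative/…FalseOfEnergyUnboundedNegZM.lean`).

References: U. Frisch, *Turbulence* (1995) §2.2; C. R. Doering, C. Foias, J. Fluid Mech. 467 (2002) §§2–3;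
C. Foias, O. Manley, R. Rosa, R. Temam, *Navier–Stokes Equations and Turbulence* (2001), (13.11), p. 71.
-/

-- `Summit.<Summit>.<Problem>` is the tree's mandated summit-side namespace (CONVENTIONS §2); for this
-- single-conjunct summit the two coincide, so the duplicate is deliberate.
set_option linter.dupNamespace false

noncomputable section

open MeasureTheory Filter Set Function
open scoped InnerProductSpace RealInnerProductSpace
open Literature.Analysis.FunctionSpaces Literature.Analysis.FunctionSpaces.Torus
open Literature.Analysis.FluidPDE Literature.Analysis.FluidPDE.Torus

namespace Summit.AnomalousDissipation.AnomalousDissipation.Theorems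

/-! ## Registered sub-goals: the `T³` instances of the Galilean covariance theorems -/

/-- **Galilean covariance of forced weak Navier–Stokes solutions on `T³`** (registered sub-goal
`lhGalilean_isWeakNSSolutionForcedOn`; `Torus.IsWeakNSSolutionForcedOn.galilean_unboost`). [folklore] -/
theorem lhGalilean_isWeakNSSolutionForcedOn :
    ∀ (T ν : ℝ) (V : EuclideanSpace ℝ (Fin 3)) (f : UnitAddTorus (Fin 3) → EuclideanSpace ℝ (Fin 3)) (u₀ : UnitAddTorus (Fin 3) → EuclideanSpace ℝ (Fin 3)) (u : ℝ → UnitAddTorus (Fin 3) → EuclideanSpace ℝ (Fin 3)), IsSmooth f → MeasureTheory.Integrable u₀ MeasureTheory.volume → IsWeakNSSolutionForcedOn T ν (fun _ => f) u₀ u → IsWeakNSSolutionForcedOn T ν (fun t y => f (y + Literature.Analysis.FunctionSpaces.Torus.proj (t • V))) (fun y => u₀ y - V) (fun t y => u t (y + Literature.Analysis.FunctionSpaces.Torus.proj (t • V)) - V) :=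
  fun _ _ V _ _ _ hf hu₀ hu => hu.galilean_unboost hf hu₀ V

/-- **Galilean covariance of Leray–Hopf solutions on `T³ × [0, T)`** (registered sub-goal `lhGalilean_isLerayHopfOn`;
`Torus.IsLerayHopfOn.galilean_unboost`). [folklore] -/
theorem lhGalilean_isLerayHopfOn :
    ∀ (T ν : ℝ) (V : EuclideanSpace ℝ (Fin 3)) (f : UnitAddTorus (Fin 3) → EuclideanSpace ℝ (Fin 3)) (u₀ : UnitAddTorus (Fin 3) → EuclideanSpace ℝ (Fin 3)) (u : ℝ → UnitAddTorus (Fin 3) → EuclideanSpace ℝ (Fin 3)), 0 < T → IsSmooth f → HasZeroMean f → u 0 = u₀ → IsLerayHopfOn T ν (fun _ => f) u₀ u → IsLerayHopfOn T ν (fun t y => f (y + Literature.Analysis.FunctionSpaces.Torus.proj (t • V))) (fun y => u₀ y - V) (fun t y => u t (y + Literature.Analysis.FunctionSpaces.Torus.proj (t • V)) - V) :=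
  fun _ _ V _ _ _ hT hf hf0 h0 h => h.galilean_unboost hT hf hf0 h0 V

/-- **Galilean covariance of global Leray–Hopf solutions on `T³`** (registered sub-goal `lhGalilean_isGlobalLerayHopf`;
`Torus.IsGlobalLerayHopf.galilean_unboost`). [folklore] -/
theorem lhGalilean_isGlobalLerayHopf :
    ∀ (ν : ℝ) (V : EuclideanSpace ℝ (Fin 3)) (f : UnitAddTorus (Fin 3) → EuclideanSpace ℝ (Fin 3)) (u₀ : UnitAddTorus (Fin 3) → EuclideanSpace ℝ (Fin 3)) (u : ℝ → UnitAddTorus (Fin 3) → EuclideanSpace ℝ (Fin 3)), IsSmooth f → HasZeroMean f → u 0 = u₀ → IsGlobalLerayHopf ν (fun _ => f) u₀ u → IsGlobalLerayHopf ν (fun t y => f (y + Literature.Analysis.FunctionSpaces.Torus.proj (t • V))) (fun y => u₀ y - V) (fun t y => u t (y + Literature.Analysis.FunctionSpaces.Torus.proj (t • V)) - V) :=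
  fun _ V _ _ _ hf hf0 h0 h => h.galilean_unboost hf hf0 h0 V

namespace BoundedEnergyNoLeakGridHardnessLH

/-- The drift velocity `e₀`. [folklore] -/
private theorem norm_single_zero_one : ‖(EuclideanSpace.single (0 : Fin 3) (1 : ℝ))‖ = 1 := by simp

/-- Along the columns the swept pattern is the pattern: `G (y + [t e₀]) = G y` for an `x₀`-invariant `G`. [folklore] -/
theorem apply_add_proj_smul_single_zero {G : UnitAddTorus (Fin 3) → EuclideanSpace ℝ (Fin 3)}
    (hGinv : ∀ (s : UnitAddCircle) x, G (x + Pi.single (0 : Fin 3) s) = G x) (t : ℝ) (y : UnitAddTorus (Fin 3)) :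
    G (y + proj (t • EuclideanSpace.single (0 : Fin 3) (1 : ℝ))) = G y := by
  rw [proj_smul_single, hGinv]

/-- **Unboosting a uniform-energy drift family of global Leray–Hopf solutions** under a columnar force `G`
(`x₀`-invariant, smooth, mean zero), drift datum `∫ u₀ j = e₀`, viscosities `ν_j > 0`: in the frame moving with `e₀`
(time-zero slices normalised to the data) one gets global Leray–Hopf solutions under the SAME force `G` from
ZERO-MOMENTUM data, with mean energies `≤ 2E + 2`, the same mean power input and the same mean dissipation. [folklore] -/
theorem unboost_lh_family {G : UnitAddTorus (Fin 3) → EuclideanSpace ℝ (Fin 3)} (hGs : IsSmooth G)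
    (hGinv : ∀ (s : UnitAddCircle) x, G (x + Pi.single (0 : Fin 3) s) = G x) (hGmean : HasZeroMean G)
    {ν : ℕ → ℝ} {u₀ : ℕ → UnitAddTorus (Fin 3) → EuclideanSpace ℝ (Fin 3)}
    {u : ℕ → ℝ → UnitAddTorus (Fin 3) → EuclideanSpace ℝ (Fin 3)}
    (hν : ∀ j, 0 < ν j) (hLH : ∀ j, IsGlobalLerayHopf (ν j) (fun _ => G) (u₀ j) (u j))
    (hdat : ∀ j, ∫ x, u₀ j x = EuclideanSpace.single (0 : Fin 3) (1 : ℝ)) {E : ℝ} (hE : ∀ j, meanEnergy (u j) ≤ E) :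
    ∃ (v₀ : ℕ → UnitAddTorus (Fin 3) → EuclideanSpace ℝ (Fin 3)) (v : ℕ → ℝ → UnitAddTorus (Fin 3) → EuclideanSpace ℝ (Fin 3)),
      (∀ j, HasZeroMean (v₀ j)) ∧ (∀ j, IsGlobalLerayHopf (ν j) (fun _ => G) (v₀ j) (v j)) ∧
      (∀ j, meanEnergy (v j) ≤ 2 * E + 2) ∧
      (∀ j, longTimeAvgSup (fun t => ∫ y, ⟪G y, v j t y⟫) = longTimeAvgSup (fun t => ∫ x, ⟪G x, u j t x⟫)) ∧
      (∀ j, meanDissipation (ν j) (v j) = meanDissipation (ν j) (u j)) := by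
  set V : EuclideanSpace ℝ (Fin 3) := EuclideanSpace.single (0 : Fin 3) (1 : ℝ) with hV
  -- the data are integrable (their integral is `e₀ ≠ 0`), hence measurable, hence in `L²`
  have hint : ∀ j, Integrable (u₀ j) volume := fun j => by
    by_contra h
    have h0 := integral_undef h
    rw [hdat j] at h0
    have := congrArg (fun w : EuclideanSpace ℝ (Fin 3) => w 0) h0
    simp [hV] at this
  have hL2 : ∀ j, MemLp (u₀ j) 2 volume := fun j => (hLH j).memLp_two_datum (hint j).aestronglyMeasurable
  -- the swept force is the force
  have hswept : (fun (t : ℝ) (y : UnitAddTorus (Fin 3)) => G (y + proj (t • V))) = fun _ => G := by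
    funext t y; rw [hV]; exact apply_add_proj_smul_single_zero hGinv t y
  set v : ℕ → ℝ → UnitAddTorus (Fin 3) → EuclideanSpace ℝ (Fin 3) :=
    fun j t y => update (u j) 0 (u₀ j) t (y + proj (t • V)) - V with hv
  have hvw : ∀ j t, 0 < t → v j t = fun y => u j t (y + proj (t • V)) - V := fun j t ht => by
    funext y; simp only [hv, update_of_ne ht.ne']
  have hvLH : ∀ j, IsGlobalLerayHopf (ν j) (fun _ => G) (fun y => u₀ j y - V) (v j) := fun j => by
    have h := (hLH j).galilean_unboost_update hGs hGmean (hL2 j) V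
    rwa [hswept] at h
  refine ⟨fun j y => u₀ j y - V, v, fun j => ?_, hvLH, fun j => ?_, fun j => ?_, fun j => ?_⟩
  · -- zero momentum
    show ∫ y, (u₀ j y - V) = 0
    rw [integral_sub (hint j) (integrable_const V), integral_const, probReal_univ, one_smul, hdat j, hV, sub_self]
  · -- mean energy
    rw [meanEnergy_congr_of_eqOn_Ioi (u := fun t y => u j t (y + proj (t • V)) - V) (hvw j)]
    have h := (hLH j).meanEnergy_galilean_le (hν j) hGs hGmean V
    have h1 : ‖V‖ = 1 := by rw [hV]; exact norm_single_zero_one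
    rw [h1, one_pow, mul_one] at h
    have := hE j
    linarith
  · -- mean power input
    calc longTimeAvgSup (fun t => ∫ y, ⟪G y, v j t y⟫)
        = longTimeAvgSup (fun t => ∫ y, ⟪G (y + proj (t • V)), u j t (y + proj (t • V)) - V⟫) :=
          longTimeAvgSup_congr_of_eqOn_Ioi fun t ht => by
            rw [hvw j t ht]
            simp only [hV, apply_add_proj_smul_single_zero hGinv]
      _ = longTimeAvgSup (fun t => ∫ x, ⟪G x, u j t x⟫) := (hLH j).longTimeAvgSup_work_galilean hGs hGmean V
  · -- mean dissipation
    rw [meanDissipation_congr_of_eqOn_Ioi (u := fun t y => u j t (y + proj (t • V)) - V) (hvw j)]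
    exact (hLH j).meanDissipation_galilean V

end BoundedEnergyNoLeakGridHardnessLH

open BoundedEnergyNoLeakGridHardnessLH RegularDriftStatesHardness

/-- **UEDF ⇒ `Correlation.BoundedEnergyFamilyZM`** (stmt-AnomalousDissipation-14641): the necessary Leray–Hopf residual
of the crux, at the design `Φ ≡ 1`, `G = sin(2πx₁)e₂`, `c = 1`, unboosted to zero momentum. [folklore] -/
theorem boundedEnergyFamilyZM_of_uniformEnergyDriftFamilies :
    (∀ (Φ : UnitAddTorus (Fin 3) → ℝ) (G : UnitAddTorus (Fin 3) → EuclideanSpace ℝ (Fin 3)) (c : ℝ), IsSmooth Φ → IsSmooth G → (∀ (s : UnitAddCircle) x, Φ (x + Pi.single (1 : Fin 3) s) = Φ x ∧ Φ (x + Pi.single (2 : Fin 3) s) = Φ x) → (∫ x, Φ x = 1) → (∀ (s : UnitAddCircle) x, G (x + Pi.single (0 : Fin 3) s) = G x) → (∀ x, G x 0 = 0) → IsSmooth (fun x => Φ x • G x) → IsDivFree (fun x => Φ x • G x) → HasZeroMean (fun x => Φ x • G x) → 0 < c → ∃ (ν : ℕ → ℝ) (u₀ : ℕ → UnitAddTorus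 (Fin 3) → EuclideanSpace ℝ (Fin 3)) (u : ℕ → ℝ → UnitAddTorus (Fin 3) → EuclideanSpace ℝ (Fin 3)), (∀ j, 0 < ν j) ∧ Filter.Tendsto ν Filter.atTop (nhds 0) ∧ (∀ j, IsGlobalLerayHopf (ν j) (fun _ => fun x => Φ x • G x) (u₀ j) (u j)) ∧ (∀ j, ∫ x, u₀ j x = c • EuclideanSpace.single 0 1) ∧ (∃ E : ℝ, ∀ j, meanEnergy (u j) ≤ E)) → Summit.AnomalousDissipation.AnomalousDissipation.Theses.Correlation.BoundedEnergyFamilyZM := by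
  intro hU
  obtain ⟨G, hGs, hGinv, hG0, hGdiv, hGmean, hGne⟩ := exists_columnar_pattern
  have hF : (fun x : UnitAddTorus (Fin 3) => (1 : ℝ) • G x) = G := funext fun x => one_smul ℝ (G x)
  have hΦ1 : ∫ _ : UnitAddTorus (Fin 3), (1 : ℝ) = 1 := by rw [integral_const, probReal_univ, one_smul]
  obtain ⟨ν, u₀, u, hν, hν0, hLH, hdat, E, hE⟩ := hU (fun _ => 1) G 1 (isSmooth_const _) hGs
    (fun _ _ => ⟨rfl, rfl⟩) hΦ1 hGinv hG0 (by rw [hF]; exact hGs) (by rw [hF]; exact hGdiv)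
    (by rw [hF]; exact hGmean) one_pos
  rw [hF] at hLH
  simp only [one_smul] at hdat
  obtain ⟨v₀, v, hv0, hvLH, hvE, -, -⟩ := unboost_lh_family hGs hGinv hGmean hν hLH hdat hE
  exact ⟨G, hGs, hGdiv, hGmean, hGne, ν, v₀, v, hν, hν0, hv0, hvLH, ⟨2 * E + 2, hvE⟩⟩

/-- **crux ⇒ `Correlation.BoundedEnergyFamilyZM`** (stmt-AnomalousDissipation-14641), through the necessary residual UEDF. [folklore] -/
theorem boundedEnergyFamilyZM_of_boundedEnergyNoLeakGrid :
    Summit.AnomalousDissipation.AnomalousDissipation.Theses.ImpulseGrid.BoundedEnergyNoLeakGrid → Summit.AnomalousDissipation.AnomalousDissipation.Theses.Correlation.BoundedEnergyFamilyZM :=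
  fun h => boundedEnergyFamilyZM_of_uniformEnergyDriftFamilies (uniformEnergyDriftFamilies_of_boundedEnergyNoLeakGrid h)

/-- **crux ⇒ `Correlation.BoundedEnergyEqualityZM`** (stmt-AnomalousDissipation-14640): the crux's no-leakage clause is frame
independent (same mean power input, same mean dissipation), so it passes to the zero-momentum family. [folklore] -/
theorem boundedEnergyEqualityZM_of_boundedEnergyNoLeakGrid :
    Summit.AnomalousDissipation.AnomalousDissipation.Theses.ImpulseGrid.BoundedEnergyNoLeakGrid → Summit.AnomalousDissipation.AnomalousDissipation.Theses.Correlation.BoundedEnergyEqualityZM := by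
  intro hX
  obtain ⟨G, hGs, hGinv, hG0, hGdiv, hGmean, hGne⟩ := exists_columnar_pattern
  have hF : (fun x : UnitAddTorus (Fin 3) => (1 : ℝ) • G x) = G := funext fun x => one_smul ℝ (G x)
  have hΦ1 : ∫ _ : UnitAddTorus (Fin 3), (1 : ℝ) = 1 := by rw [integral_const, probReal_univ, one_smul]
  obtain ⟨ν, u₀, u, hν, hν0, hLH, -, hdat, ⟨E, hE⟩, hNL⟩ := hX (fun _ => 1) G 1 (isSmooth_const _) hGs
    (fun _ _ => ⟨rfl, rfl⟩) hΦ1 hGinv hG0 (by rw [hF]; exact hGs) (by rw [hF]; exact hGdiv)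
    (by rw [hF]; exact hGmean) one_pos
  rw [hF] at hLH
  simp only [one_smul] at hdat hNL
  obtain ⟨v₀, v, hv0, hvLH, hvE, hwork, hdiss⟩ := unboost_lh_family hGs hGinv hGmean hν hLH hdat hE
  refine ⟨G, hGs, hGdiv, hGmean, hGne, ν, v₀, v, hν, hν0, hv0, hvLH, ⟨2 * E + 2, hvE⟩, fun j => ?_⟩
  rw [hwork j, hdiss j]
  exact hNL j

end Summit.AnomalousDissipation.AnomalousDissipation.Theorems
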